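import Summits.HodgeConjecture.HodgeConjecture.Theses.GenericDivisibility
import Literature.AlgebraicGeometry.Motives.ClosedGraphMorphism
import Literature.AlgebraicTopology.SingularHomology.CohomologyOfPoint

/-!
# `HodgeClassesGenericallyDivisible` (C1, stmt-HodgeConjecture-18466) · Negative · the guard `IsClosed Z`

Negative knowledge for the crux `GenericDivisibility.HodgeClassesGenericallyDivisible` (route
GenericDivisibility, rank 2), from the standing disprover's work file
`Cruxes/HodgeClassesGenericallyDivisible/Disproof.lean` (§(a), guard `IsClosed Z`): together with
`…/Negative/LoadBearing.lean` (`Z ≠ univ`) this completes the guard analysis of the conclusion.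

* `hodgeClassesGenericallyDivisible_withoutIsClosed` — with the requirement that the removed set
  `Z` be Zariski-CLOSED deleted, C1 holds trivially: take `Z = X ∖ {P₀.pt}` for any complex point
  `P₀` (it exists: closed points of the Jacobson space `X` are complex points, Nullstellensatz); then
  `Z ≠ univ`, the complex points off `Z` are exactly those over the closed point `P₀.pt`, i.e. `P₀`
  alone (`AlgPoints.eq_of_pt_eq`), and `H²ᵖ(pt; ℤ) = 0` for `p ≥ 1`, so `y = 0` works.  Hence both
  guards `IsClosed Z` and `Z ≠ univ` are needed for C1 to have content, and neither can be weakened.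
Refuter seat refuter-cdisprove-stmt-HodgeConjecture-18466-0 (cdisprove cycle 1), 2026-08-17.
-/

noncomputable section

-- The mandated namespace `Summit.<P>.<Sub>.Theorems.…` repeats `HodgeConjecture` (single-conjunct summit).
set_option linter.dupNamespace false

namespace Summit.HodgeConjecture.HodgeConjecture.Theorems.HodgeClassesGenericallyDivisible.Negative.ClosedGuard

open CategoryTheory AlgebraicGeometry
open Literature.AlgebraicGeometry.Motives Literature.AlgebraicGeometry.HodgeTheory
  Literature.AlgebraicTopology.SingularHomology

/-- **A smooth projective complex variety has a complex point** (it is non-empty, being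
geometrically irreducible, and a closed point of the Jacobson space `X` — `X → Spec ℂ` is locally of
finite type — underlies a `ℂ`-point by the Nullstellensatz). [cite: Hartshorne1977, II Ex. 2.14 and I.1] -/
theorem nonempty_complexPoints {n : ℕ} {X : SchemeOver ℂ} (hX : IsSmoothProjective n X) :
    Nonempty (ComplexPoints X) := by
  haveI := hX.smoothOfRelativeDimension
  haveI : Smooth X.hom := SmoothOfRelativeDimension.smooth n X.hom
  haveI := hX.geometricallyIrreducible
  haveI : IrreducibleSpace X.left :=
    AlgebraicGeometry.GeometricallyIrreducible.irreducibleSpace_of_subsingleton X.hom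
  haveI : JacobsonSpace X.left := LocallyOfFiniteType.jacobsonSpace X.hom
  have h : (Set.univ ∩ closedPoints X.left).Nonempty := by
    by_contra h
    rw [Set.not_nonempty_iff_eq_empty] at h
    have h2 := JacobsonSpace.closure_inter_closedPoints_eq_closure
      (isClosed_univ (X := X.left)).isLocallyClosed
    rw [h, closure_empty, closure_univ] at h2
    exact Set.empty_ne_univ h2
  obtain ⟨x, -, hxcl⟩ := h
  obtain ⟨z, -⟩ := AlgPoints.exists_pt_eq_of_isClosed_singleton (X := X) (K := ℂ)
    (mem_closedPoints_iff.mp hxcl)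
  exact ⟨z⟩

/-- **The crux WITHOUT the requirement `IsClosed Z` holds trivially.** The statement below is
`HodgeClassesGenericallyDivisible` with `IsClosed Z` deleted (everything else verbatim); witness
`Z = X ∖ {P₀.pt}` for a complex point `P₀`: the complex points off `Z` are those over the closed
point `P₀.pt`, which is `P₀` alone (`AlgPoints.eq_of_pt_eq`, residue field `ℂ`), and
`H²ᵖ(pt; ℤ) = 0` for `p ≥ 1` (`isZero_singularCohomology_of_subsingleton'`), so `y = 0`.
No hypothesis on `z` is used. [cite: HatcherAT2002, §3.1 p. 199] -/
theorem hodgeClassesGenericallyDivisible_withoutIsClosed :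
    ∀ ⦃p : ℕ⦄ ⦃X : SchemeOver ℂ⦄, 1 ≤ p → IsSmoothProjective (2 * p) X →
      ∀ z : singularCohomology ℤ ℤ (ComplexPoints X) (2 * p),
        IsOfHodgeType (2 * p) X (2 * p) p p
          (singularCohomology.ringChange (Int.castRingHom ℂ) (ComplexPoints X) (2 * p) z) →
        ∀ m : ℕ, 1 ≤ m → ∃ Z : Set X.left, Z ≠ Set.univ ∧
          ∃ y : singularCohomology ℤ ℤ (complexPointsCompl X Z) (2 * p),
            m • y = singularCohomology.map ℤ ℤ
              (⟨Subtype.val, continuous_subtype_val⟩ : C(complexPointsCompl X Z, ComplexPoints X))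
              (2 * p) z := by
  intro p X hp hX z _ m _
  obtain ⟨P₀⟩ := nonempty_complexPoints hX
  haveI := hX.smoothOfRelativeDimension
  haveI : Smooth X.hom := SmoothOfRelativeDimension.smooth (2 * p) X.hom
  refine ⟨{x | x ≠ P₀.pt}, fun h ↦ ?_, 0, ?_⟩
  · have : P₀.pt ∈ {x : X.left | x ≠ P₀.pt} := h ▸ Set.mem_univ _
    exact this rfl
  · haveI : Subsingleton (complexPointsCompl X {x | x ≠ P₀.pt}) := ⟨fun P Q ↦ Subtype.ext
      ((AlgPoints.eq_of_pt_eq (not_not.1 P.2)).trans (AlgPoints.eq_of_pt_eq (not_not.1 Q.2)).symm)⟩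
    haveI := ModuleCat.subsingleton_of_isZero
      (singularCochainComplex.isZero_singularCohomology_of_subsingleton' (R := ℤ) (M := ℤ)
        (X := complexPointsCompl X {x | x ≠ P₀.pt}) (n := 2 * p) (by omega))
    exact Subsingleton.elim _ _

end Summit.HodgeConjecture.HodgeConjecture.Theorems.HodgeClassesGenericallyDivisible.Negative.ClosedGuard

end
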